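import Literature.Combinatorics.Enumerative.ExpLogCoefficients
import Mathlib.Data.Finset.Powerset
import Mathlib.Algebra.BigOperators.Ring.Finset
import HarnessLib

/-!
# The convolution algebra of set functions; Ford–Maynard's Linnik function (Lemmas 5.4, 5.5)

Everything here is PROVED.

* `sconv F G A = ∑_{B ⊆ A} F(B) G(A ∖ B)` — the (commutative, associative, unital) disjoint-union
  convolution of real set functions on `Finset α`; `spow F n = F^{⋆n}` (`F^{⋆0} = δ = [· = ∅]`);
  bilinearity, `sconv_comm`, `sconv_assoc`, `spow_add`, nilpotency `spow_eq_zero_of_card_lt`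
  (`F(∅) = 0 ⇒ F^{⋆n}(A) = 0` for `|A| < n`), locality `spow_congr`, and the exact expansion
  `spow_sum_spow`: `(∑_{j=1}^{J} c_j ν^{⋆j})^{⋆r}(A) = ∑_{n=1}^{N} E_r(n) ν^{⋆n}(A)` for `|A| ≤ N ≤ J`
  (`E_r = compSum c r`, `Literature/Combinatorics/Enumerative/ExpLogCoefficients.lean`).
* `smallFn c x B = [B ≠ ∅ ∧ ∑_{i∈B} x_i < c]` and **Ford–Maynard's Linnik function**
  `linnikFn c x A = ∑_{j=1}^{|α|} ((−1)^{j+1}/j) · smallFn^{⋆j}(A)`; here `smallFn^{⋆j}(A)` is the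
  number of ways to write the subvector `x_A` as an ordered disjoint union of `j` nonempty
  subvectors each with sum `< c`, so `linnikFn c x A = 𝓛_c(x_A)` of
  [FordMaynard2024PrimeSieves, Definition (Linnik-fcn), §5.1] (arXiv:2407.14368), simultaneously
  for all subvectors `A ⊆ α` of `x = (x_i)_{i ∈ α}`.
* `linnikFn_eq_zero_of_mem` = Lemma 5.5(a); `linnikFn_eq_of_sum_lt` = Lemma 5.5(b) (proved as the
  identity `log_⋆(exp_⋆ π) = π` for the singleton indicator `π`, via `bCoeff_eq`);
  `sum_spow_linnikFn`: `∑_{r=1}^{R} (m^r/r!) 𝓛^{⋆r}(A) = ∑_{n=1}^{K} C(m,n) smallFn^{⋆n}(A)`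
  (`exp_⋆(m log_⋆(δ+N)) = (δ+N)^{⋆m}`, via `aCoeff_eq`), and **Lemma 5.4**
  `FordMaynard_lemma_5_4`: if `∑ x_i ≥ m c`, `c > 0`, then
  `∑_{r ≥ 1} (m^r/r!) ∑_{u₁ ⊔ ⋯ ⊔ u_r = x} ∏ 𝓛_c(u_i) = 𝟎`, the inner sum over ordered
  decompositions into `r` possibly empty subvectors being `linnikFn^{⋆r}(univ)` (pigeonhole:
  `smallFn^{⋆n}(univ) = 0` for `n ≤ m`).

These are the combinatorial identities used in Ford–Maynard's Theorem 6.4 ((fsl) ⇒ (TypeI-f)).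
-/

noncomputable section

open Finset

namespace Literature.Combinatorics.Enumerative

section SetFn

variable {α : Type*} [DecidableEq α]

/-- Disjoint-union convolution of set functions: `(F ⋆ G)(A) = ∑_{B ⊆ A} F(B) G(A ∖ B)`. [folklore] -/
def sconv (F G : Finset α → ℝ) (A : Finset α) : ℝ := ∑ B ∈ A.powerset, F B * G (A \ B)

/-- The unit `δ(A) = [A = ∅]`. [folklore] -/
def sdelta (A : Finset α) : ℝ := if A = ∅ then 1 else 0

/-- Convolution powers `F^{⋆n}`, `F^{⋆0} = δ`. [folklore] -/
def spow (F : Finset α → ℝ) : ℕ → Finset α → ℝ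
  | 0 => sdelta
  | n + 1 => sconv F (spow F n)

/-- `F^{⋆0} = δ`. [folklore] -/
@[simp] theorem spow_zero (F : Finset α → ℝ) : spow F 0 = sdelta := rfl
/-- `F^{⋆(n+1)} = F ⋆ F^{⋆n}`. [folklore] -/
theorem spow_succ (F : Finset α → ℝ) (n : ℕ) : spow F (n + 1) = sconv F (spow F n) := rfl

/-- `δ(∅) = 1`. [folklore] -/
theorem sdelta_empty : sdelta (∅ : Finset α) = 1 := by simp [sdelta]
/-- `δ(A) = 0` for `A ≠ ∅`. [folklore] -/
theorem sdelta_of_ne {A : Finset α} (h : A ≠ ∅) : sdelta A = 0 := by simp [sdelta, h]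

/-- **Commutativity** of `⋆`. [folklore] -/
theorem sconv_comm (F G : Finset α → ℝ) : sconv F G = sconv G F := by
  funext A
  unfold sconv
  refine Finset.sum_nbij' (fun B => A \ B) (fun B => A \ B) ?_ ?_ ?_ ?_ ?_
  · intro B _; simp
  · intro B _; simp
  · intro B hB; rw [mem_powerset] at hB; exact Finset.sdiff_sdiff_eq_self hB
  · intro B hB; rw [mem_powerset] at hB; exact Finset.sdiff_sdiff_eq_self hB
  · intro B hB; rw [mem_powerset] at hB; rw [Finset.sdiff_sdiff_eq_self hB, mul_comm]

/-- `δ ⋆ F = F`. [folklore] -/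
theorem sdelta_sconv (F : Finset α → ℝ) : sconv sdelta F = F := by
  funext A
  unfold sconv
  rw [Finset.sum_eq_single_of_mem ∅ (empty_mem_powerset A)]
  · simp [sdelta_empty]
  · intro B _ hB; rw [sdelta_of_ne hB, zero_mul]

/-- `F ⋆ δ = F`. [folklore] -/
theorem sconv_sdelta (F : Finset α → ℝ) : sconv F sdelta = F := by
  rw [sconv_comm, sdelta_sconv]

/-- Left distributivity over `+`. [folklore] -/
theorem sconv_add (F G H : Finset α → ℝ) :
    sconv F (fun A => G A + H A) = fun A => sconv F G A + sconv F H A := by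
  funext A; simp [sconv, mul_add, Finset.sum_add_distrib]

/-- Right distributivity over `+`. [folklore] -/
theorem add_sconv (F G H : Finset α → ℝ) :
    sconv (fun A => F A + G A) H = fun A => sconv F H A + sconv G H A := by
  funext A; simp [sconv, add_mul, Finset.sum_add_distrib]

/-- Scalars pull out of the second factor. [folklore] -/
theorem sconv_const_mul (c : ℝ) (F G : Finset α → ℝ) :
    sconv F (fun A => c * G A) = fun A => c * sconv F G A := by
  funext A; simp only [sconv, Finset.mul_sum]; exact Finset.sum_congr rfl fun B _ => by ring

/-- Scalars pull out of the first factor. [folklore] -/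
theorem const_mul_sconv (c : ℝ) (F G : Finset α → ℝ) :
    sconv (fun A => c * F A) G = fun A => c * sconv F G A := by
  funext A; simp only [sconv, Finset.mul_sum]; exact Finset.sum_congr rfl fun B _ => by ring

/-- `F ⋆ 0 = 0`. [folklore] -/
theorem sconv_zero (F : Finset α → ℝ) : sconv F (fun _ => 0) = fun _ => 0 := by
  funext A; simp [sconv]

/-- `⋆` commutes with finite sums in the second factor. [folklore] -/
theorem sconv_sum {ι : Type*} (s : Finset ι) (F : Finset α → ℝ) (G : ι → Finset α → ℝ) :
    sconv F (fun A => ∑ i ∈ s, G i A) = fun A => ∑ i ∈ s, sconv F (G i) A := by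
  funext A
  simp only [sconv, Finset.mul_sum]
  rw [Finset.sum_comm]

/-- **Associativity** of `⋆`. [folklore] -/
theorem sconv_assoc (F G H : Finset α → ℝ) : sconv (sconv F G) H = sconv F (sconv G H) := by
  funext A
  simp only [sconv, Finset.sum_mul, Finset.mul_sum]
  rw [Finset.sum_sigma', Finset.sum_sigma']
  -- `(B, C)` with `C ⊆ B ⊆ A`  ↔  `(C, D)` with `C ⊆ A`, `D ⊆ A ∖ C`, via `D = B ∖ C`, `B = C ∪ D`
  refine Finset.sum_nbij' (fun p => ⟨p.2, p.1 \ p.2⟩) (fun q => ⟨q.1 ∪ q.2, q.1⟩) ?_ ?_ ?_ ?_ ?_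
  · rintro ⟨B, C⟩ h
    simp only [Finset.mem_sigma, mem_powerset] at h ⊢
    exact ⟨h.2.trans h.1, sdiff_subset_sdiff h.1 (le_refl _)⟩
  · rintro ⟨C, D⟩ h
    simp only [Finset.mem_sigma, mem_powerset] at h ⊢
    refine ⟨union_subset h.1 ((h.2.trans sdiff_subset)), subset_union_left⟩
  · rintro ⟨B, C⟩ h
    simp only [Finset.mem_sigma, mem_powerset] at h
    simp only [union_sdiff_of_subset h.2]
  · rintro ⟨C, D⟩ h
    simp only [Finset.mem_sigma, mem_powerset] at h
    have hdisj : Disjoint C D := disjoint_of_subset_right h.2 disjoint_sdiff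
    simp only [union_sdiff_left, sdiff_eq_self_of_disjoint hdisj.symm]
  · rintro ⟨B, C⟩ h
    simp only [Finset.mem_sigma, mem_powerset] at h
    simp only
    rw [sdiff_sdiff_left, show C ⊔ B \ C = B from union_sdiff_of_subset h.2, mul_assoc]

/-- `F^{⋆(m+n)} = F^{⋆m} ⋆ F^{⋆n}`. [folklore] -/
theorem spow_add (F : Finset α → ℝ) (m n : ℕ) : spow F (m + n) = sconv (spow F m) (spow F n) := by
  induction m with
  | zero => rw [zero_add, spow_zero, sdelta_sconv]
  | succ m ih => rw [show m + 1 + n = (m + n) + 1 by ring, spow_succ, ih, ← sconv_assoc, ← spow_succ]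

/-- **Nilpotency**: if `F(∅) = 0` then `F^{⋆n}(A) = 0` whenever `|A| < n`. [folklore] -/
theorem spow_eq_zero_of_card_lt {F : Finset α → ℝ} (h0 : F ∅ = 0) :
    ∀ {n : ℕ} {A : Finset α}, A.card < n → spow F n A = 0
  | 0, _, h => (Nat.not_lt_zero _ h).elim
  | n + 1, A, h => by
    rw [spow_succ, sconv]
    refine Finset.sum_eq_zero fun B hB => ?_
    rw [mem_powerset] at hB
    by_cases hBe : B = ∅
    · rw [hBe, h0, zero_mul]
    · have hcard : (A \ B).card < n := by
        have h1 := card_sdiff_add_card_eq_card hB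
        have h2 : 0 < B.card := card_pos.2 (nonempty_iff_ne_empty.2 hBe)
        omega
      rw [spow_eq_zero_of_card_lt h0 hcard, mul_zero]

/-- `F^{⋆(n+1)}(∅) = 0` when `F(∅) = 0`. [folklore] -/
theorem spow_succ_empty {F : Finset α → ℝ} (h0 : F ∅ = 0) (n : ℕ) : spow F (n + 1) ∅ = 0 :=
  spow_eq_zero_of_card_lt h0 (by simp)

/-- Locality in the second factor is automatic; we record the analogue of the shift identity:
for `r ≥ 1` and `G` vanishing above `N`, `∑_{n=1}^{N} E_r(n) G(j+n) = ∑_{s=1}^{N} E_r(s−j) G(s)`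
(this is `sum_compSum_shift` of `OneSidedConvolutionPowers.lean`, restated to keep imports light).
[folklore] -/
theorem sum_compSum_shift' (c : ℕ → ℝ) {r : ℕ} (hr : 1 ≤ r) {N : ℕ} (G : ℕ → ℝ)
    (hG : ∀ s, N < s → G s = 0) (j : ℕ) :
    ∑ n ∈ Finset.Icc 1 N, compSum c r n * G (j + n) = ∑ s ∈ Finset.Icc 1 N, compSum c r (s - j) * G s := by
  have h0 : compSum c r 0 = 0 := compSum_eq_zero_of_lt c (by omega)
  have hL : ∑ n ∈ Finset.Icc 1 N, compSum c r n * G (j + n) =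
      ∑ n ∈ Finset.range (N + 1), compSum c r n * G (j + n) := by
    rw [show Finset.Icc 1 N = Finset.Ico 1 (N + 1) by rfl, Finset.range_eq_Ico]
    refine Finset.sum_subset (Finset.Ico_subset_Ico_left (by omega)) fun n hn hn' => ?_
    have : n = 0 := by simp only [Finset.mem_Ico] at hn hn'; omega
    rw [this, h0, zero_mul]
  have hR : ∑ s ∈ Finset.Icc 1 N, compSum c r (s - j) * G s =
      ∑ s ∈ Finset.range (j + (N + 1)), compSum c r (s - j) * G s := by
    rw [show Finset.Icc 1 N = Finset.Ico 1 (N + 1) by rfl, Finset.range_eq_Ico]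
    refine Finset.sum_subset (Finset.Ico_subset_Ico (by omega) (by omega)) fun s hs hs' => ?_
    simp only [Finset.mem_Ico] at hs hs'
    rcases Nat.eq_zero_or_pos s with h | h
    · subst h; rw [Nat.zero_sub, h0, zero_mul]
    · rw [hG s (by omega), mul_zero]
  rw [hL, hR, Finset.sum_range_add (fun s => compSum c r (s - j) * G s) j (N + 1)]
  have hfirst : ∑ s ∈ Finset.range j, compSum c r (s - j) * G s = 0 := by
    refine Finset.sum_eq_zero fun s hs => ?_
    rw [Finset.mem_range] at hs
    rw [Nat.sub_eq_zero_of_le hs.le, h0, zero_mul]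
  rw [hfirst, zero_add]
  exact Finset.sum_congr rfl fun n _ => by rw [Nat.add_sub_cancel_left]

/-- **Expansion of powers of a combination of powers** (exact, set-function version): if
`ν(∅) = 0`, `N ≤ J` and `|A| ≤ N`, then for `r ≥ 1`
`(∑_{j=1}^{J} c_j ν^{⋆j})^{⋆r}(A) = ∑_{n=1}^{N} E_r(n) ν^{⋆n}(A)`, `E_r = compSum c r`. [folklore] -/
theorem spow_sum_spow {ν : Finset α → ℝ} (h0 : ν ∅ = 0) (c : ℕ → ℝ) {J N : ℕ} (hNJ : N ≤ J)
    {r : ℕ} (hr : 1 ≤ r) :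
    ∀ A : Finset α, A.card ≤ N →
      spow (fun B => ∑ j ∈ Finset.Icc 1 J, c j * spow ν j B) r A =
        ∑ n ∈ Finset.Icc 1 N, compSum c r n * spow ν n A := by
  have hvan : ∀ n, N < n → ∀ A : Finset α, A.card ≤ N → spow ν n A = 0 := fun n hn A hA =>
    spow_eq_zero_of_card_lt h0 (lt_of_le_of_lt hA hn)
  -- the truncated combination agrees with the full one on sets of size `≤ N`
  have hSN : ∀ A : Finset α, A.card ≤ N →
      ∑ j ∈ Finset.Icc 1 J, c j * spow ν j A = ∑ j ∈ Finset.Icc 1 N, c j * spow ν j A := by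
    intro A hA
    refine (Finset.sum_subset (Finset.Icc_subset_Icc_right hNJ) fun j hj hjN => ?_).symm
    simp only [Finset.mem_Icc, not_and, not_le] at hj hjN
    rw [hvan j (hjN hj.1) A hA, mul_zero]
  induction r, hr using Nat.le_induction with
  | base =>
    intro A hA
    rw [show spow (fun B => ∑ j ∈ Finset.Icc 1 J, c j * spow ν j B) 1 A =
      ∑ j ∈ Finset.Icc 1 J, c j * spow ν j A by rw [spow_succ, spow_zero, sconv_sdelta], hSN A hA]
    exact Finset.sum_congr rfl fun n hn => by rw [compSum_one c (Finset.mem_Icc.1 hn).1]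
  | succ r hr ih =>
    intro A hA
    rw [spow_succ, sconv]
    -- on each subset `B ⊆ A` both factors may be replaced using `|B|, |A ∖ B| ≤ N`
    have hrepl : ∀ B ∈ A.powerset,
        (∑ j ∈ Finset.Icc 1 J, c j * spow ν j B) *
          spow (fun B => ∑ j ∈ Finset.Icc 1 J, c j * spow ν j B) r (A \ B) =
        (∑ j ∈ Finset.Icc 1 N, c j * spow ν j B) *
          ∑ n ∈ Finset.Icc 1 N, compSum c r n * spow ν n (A \ B) := by
      intro B hB
      rw [mem_powerset] at hB
      rw [hSN B ((card_le_card hB).trans hA), ih (A \ B) ((card_le_card sdiff_subset).trans hA)]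
    rw [Finset.sum_congr rfl hrepl]
    -- bilinear expansion: ∑_B (∑_j …)(∑_n …) = ∑_j ∑_n c_j E_r(n) (ν^j ⋆ ν^n)(A) = ∑_j ∑_n c_j E_r(n) ν^{j+n}(A)
    have step : ∑ B ∈ A.powerset, (∑ j ∈ Finset.Icc 1 N, c j * spow ν j B) *
        (∑ n ∈ Finset.Icc 1 N, compSum c r n * spow ν n (A \ B)) =
        ∑ j ∈ Finset.Icc 1 N, c j * ∑ n ∈ Finset.Icc 1 N, compSum c r n * spow ν (j + n) A := by
      have : ∀ j ∈ Finset.Icc 1 N, c j * ∑ n ∈ Finset.Icc 1 N, compSum c r n * spow ν (j + n) A =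
          ∑ B ∈ A.powerset, ∑ n ∈ Finset.Icc 1 N, c j * spow ν j B * (compSum c r n * spow ν n (A \ B)) := by
        intro j _
        rw [Finset.mul_sum]
        simp_rw [spow_add, sconv, Finset.mul_sum]
        rw [Finset.sum_comm]
        exact Finset.sum_congr rfl fun B _ => Finset.sum_congr rfl fun n _ => by ring
      rw [Finset.sum_congr rfl this, Finset.sum_comm]
      refine Finset.sum_congr rfl fun B _ => ?_
      rw [Finset.sum_mul_sum]
    rw [step]
    have hinner : ∀ j ∈ Finset.Icc 1 N, ∑ n ∈ Finset.Icc 1 N, compSum c r n * spow ν (j + n) A =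
        ∑ s ∈ Finset.Icc 1 N, compSum c r (s - j) * spow ν s A := fun j _ =>
      sum_compSum_shift' c hr (fun s => spow ν s A) (fun s hs => hvan s hs A hA) j
    rw [Finset.sum_congr rfl fun j hj => by rw [hinner j hj]]
    simp_rw [Finset.mul_sum]
    rw [Finset.sum_comm]
    refine Finset.sum_congr rfl fun s hs => ?_
    have hs' := Finset.mem_Icc.1 hs
    rw [compSum_succ, Finset.sum_mul,
      ← Finset.sum_subset (Finset.Icc_subset_Icc_right hs'.2) (fun j hj hjs => ?_)]
    · exact Finset.sum_congr rfl fun j _ => by ring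
    · simp only [Finset.mem_Icc, not_and, not_le] at hj hjs
      rw [Nat.sub_eq_zero_of_le (hjs hj.1).le, compSum_eq_zero_of_lt c (by omega)]
      ring

/-- Locality: `F^{⋆n}(A)` only depends on the values of `F` on subsets of `A`. [folklore] -/
theorem spow_congr {F G : Finset α → ℝ} {A : Finset α} (h : ∀ B ⊆ A, F B = G B) :
    ∀ n, spow F n A = spow G n A := by
  intro n
  induction n generalizing A with
  | zero => rfl
  | succ n ih =>
    rw [spow_succ, spow_succ, sconv, sconv]
    refine Finset.sum_congr rfl fun B hB => ?_
    rw [mem_powerset] at hB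
    rw [h B hB, ih (fun C hC => h C (hC.trans sdiff_subset))]

/-- Homogeneity of composition sums in the weights: `E_j[a·w](n) = a^j E_j[w](n)`. [folklore] -/
theorem compSum_const_mul (a : ℝ) (w : ℕ → ℝ) :
    ∀ j n : ℕ, compSum (fun k => a * w k) j n = a ^ j * compSum w j n
  | 0, n => by
    rcases Nat.eq_zero_or_pos n with rfl | hn
    · simp
    · rw [compSum_zero_of_ne_zero _ hn.ne', compSum_zero_of_ne_zero _ hn.ne', mul_zero]
  | j + 1, n => by
    rw [compSum_succ, compSum_succ, Finset.mul_sum]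
    refine Finset.sum_congr rfl fun k _ => ?_
    rw [compSum_const_mul a w j (n - k), pow_succ]
    ring

/-- Sign rule: `E_j[(−1)^{k+1} w_k](n) = (−1)^{n+j} E_j[w](n)`. [folklore] -/
theorem compSum_negOnePow_mul' (w : ℕ → ℝ) :
    ∀ j n : ℕ, compSum (fun k => (-1) ^ (k + 1) * w k) j n = (-1) ^ (n + j) * compSum w j n
  | 0, n => by
    rcases Nat.eq_zero_or_pos n with rfl | hn
    · simp
    · rw [compSum_zero_of_ne_zero _ hn.ne', compSum_zero_of_ne_zero _ hn.ne', mul_zero]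
  | j + 1, n => by
    rw [compSum_succ, compSum_succ, Finset.mul_sum]
    refine Finset.sum_congr rfl fun k hk => ?_
    rw [compSum_negOnePow_mul' w j (n - k)]
    have hk := Finset.mem_Icc.1 hk
    have : (-1 : ℝ) ^ (k + 1) * (-1) ^ (n - k + j) = (-1) ^ (n + (j + 1)) := by
      rw [← pow_add]; congr 1; omega
    calc (-1) ^ (k + 1) * w k * ((-1) ^ (n - k + j) * compSum w j (n - k))
        = ((-1 : ℝ) ^ (k + 1) * (-1) ^ (n - k + j)) * (w k * compSum w j (n - k)) := by ring
      _ = (-1) ^ (n + (j + 1)) * (w k * compSum w j (n - k)) := by rw [this]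

/-- The logarithmic weights of the Linnik function, `(−1)^{j+1}/j`. [folklore] -/
def wLinnik (j : ℕ) : ℝ := (-1) ^ (j + 1) / j

/-- `E_r[wLinnik](n) = (−1)^n E_r[wLog](n)`. [folklore] -/
theorem compSum_wLinnik (r n : ℕ) : compSum wLinnik r n = (-1) ^ n * compSum wLog r n := by
  have h1 : wLinnik = fun k : ℕ => (-1 : ℝ) ^ (k + 1) * (1 / (k : ℝ)) := by
    funext k; simp [wLinnik, div_eq_mul_inv]
  have h2 : wLog = fun k : ℕ => (-1 : ℝ) * (1 / (k : ℝ)) := by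
    funext k; simp [wLog, div_eq_mul_inv]
  rw [h1, compSum_negOnePow_mul', h2, compSum_const_mul, pow_add]
  have : ((-1 : ℝ) ^ r) * (-1) ^ r = 1 := by rw [← mul_pow]; simp
  calc (-1 : ℝ) ^ n * (-1) ^ r * compSum (fun k => 1 / (k : ℝ)) r n
      = (-1) ^ n * (-1) ^ r * (((-1 : ℝ) ^ r * (-1) ^ r) * compSum (fun k => 1 / (k : ℝ)) r n) := by
        rw [this, one_mul]
    _ = (-1) ^ n * ((-1) ^ r * compSum (fun k => 1 / (k : ℝ)) r n) * ((-1 : ℝ) ^ r * (-1) ^ r) := by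
        ring
    _ = (-1) ^ n * ((-1) ^ r * compSum (fun k => 1 / (k : ℝ)) r n) := by rw [this, mul_one]

/-- `∑_{r=0}^{R} (m^r/r!) E_r[wLinnik](n) = C(m,n)` for `n ≤ R` (from `aCoeff_eq`). [folklore] -/
theorem sum_pow_div_factorial_mul_compSum_wLinnik (m : ℕ) {n R : ℕ} (hnR : n ≤ R) :
    ∑ r ∈ Finset.range (R + 1), (m : ℝ) ^ r / r.factorial * compSum wLinnik r n = (m.choose n : ℝ) := by
  have hA := aCoeff_eq m n
  rw [aCoeff] at hA
  have hext : ∑ r ∈ Finset.range (R + 1), (m : ℝ) ^ r / r.factorial * compSum wLog r n =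
      ∑ r ∈ Finset.range (n + 1), (m : ℝ) ^ r / r.factorial * compSum wLog r n := by
    refine (Finset.sum_subset (Finset.range_subset_range.2 (by omega)) fun r hr hrn => ?_).symm
    simp only [Finset.mem_range, not_lt] at hr hrn
    rw [compSum_eq_zero_of_lt wLog (by omega), mul_zero]
  simp_rw [compSum_wLinnik]
  calc ∑ r ∈ Finset.range (R + 1), (m : ℝ) ^ r / r.factorial * ((-1) ^ n * compSum wLog r n)
      = (-1) ^ n * ∑ r ∈ Finset.range (R + 1), (m : ℝ) ^ r / r.factorial * compSum wLog r n := by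
        rw [Finset.mul_sum]; exact Finset.sum_congr rfl fun r _ => by ring
    _ = (-1) ^ n * ((-1) ^ n * (m.choose n : ℝ)) := by rw [hext, hA]
    _ = (m.choose n : ℝ) := by rw [← mul_assoc, ← mul_pow]; simp

end SetFn

section Linnik

variable {α : Type*}

/-- The indicator of the nonempty subvectors with sum `< c`: `N_{x,c}(B) = [B ≠ ∅ ∧ ∑_{i∈B} x_i < c]`.
[cite: FordMaynard2024PrimeSieves, Def. (Linnik-fcn), §5.1] -/
def smallFn (c : ℝ) (x : α → ℝ) (B : Finset α) : ℝ :=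
  if B.Nonempty ∧ ∑ i ∈ B, x i < c then 1 else 0

/-- `N(∅) = 0`. [folklore] -/
theorem smallFn_empty (c : ℝ) (x : α → ℝ) : smallFn c x ∅ = 0 := by simp [smallFn]

/-- `N(B) = 1` for nonempty `B` with sum `< c`. [folklore] -/
theorem smallFn_eq_one {c : ℝ} {x : α → ℝ} {B : Finset α} (hB : B.Nonempty) (h : ∑ i ∈ B, x i < c) :
    smallFn c x B = 1 := by simp [smallFn, hB, h]

/-- `N(B) = 0` when the sum over `B` is `≥ c`. [folklore] -/
theorem smallFn_eq_zero {c : ℝ} {x : α → ℝ} {B : Finset α} (h : c ≤ ∑ i ∈ B, x i) :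
    smallFn c x B = 0 := by
  simp only [smallFn]; rw [if_neg]; exact fun h' => absurd h'.2 (not_lt.2 h)

variable [DecidableEq α]

/-- **Ford–Maynard's Linnik function** of the subvector `x_A` of `x = (x_i)_{i ∈ α}`:
`𝓛_c(x_A) = ∑_{j ≥ 1} ((−1)^{j+1}/j) · #{ordered decompositions of `A` into `j` nonempty
subsets each with coordinate sum `< c`}`; the count is the convolution power `N_{x,c}^{⋆j}(A)`,
and the sum may be truncated at `j = |α| ≥ |A|` (`N^{⋆j}(A) = 0` for `j > |A|`).
[cite: FordMaynard2024PrimeSieves, Def. (Linnik-fcn), §5.1] -/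
def linnikFn [Fintype α] (c : ℝ) (x : α → ℝ) (A : Finset α) : ℝ :=
  ∑ j ∈ Finset.Icc 1 (Fintype.card α), wLinnik j * spow (smallFn c x) j A

/-- `𝓛_c(x_∅) = 0`. [folklore] -/
theorem linnikFn_empty [Fintype α] (c : ℝ) (x : α → ℝ) : linnikFn c x ∅ = 0 := by
  unfold linnikFn
  refine Finset.sum_eq_zero fun j hj => ?_
  obtain ⟨j', rfl⟩ : ∃ j', j = j' + 1 := ⟨j - 1, by have := (Finset.mem_Icc.1 hj).1; omega⟩
  rw [spow_succ_empty (smallFn_empty c x), mul_zero]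

/-- **Pigeonhole**: if `∑_{i∈A} x_i ≥ n c` then `A` has no decomposition into `n ≥ 1` parts with sums
`< c`: `N^{⋆n}(A) = 0`. [cite: FordMaynard2024PrimeSieves, Lemma 5.4 (proof)] -/
theorem spow_smallFn_eq_zero (c : ℝ) (x : α → ℝ) :
    ∀ {n : ℕ}, 1 ≤ n → ∀ {A : Finset α}, (n : ℝ) * c ≤ ∑ i ∈ A, x i → spow (smallFn c x) n A = 0 := by
  intro n hn
  induction n, hn using Nat.le_induction with
  | base =>
    intro A hA
    rw [spow_succ, spow_zero, sconv_sdelta]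
    exact smallFn_eq_zero (by simpa using hA)
  | succ n hn ih =>
    intro A hA
    rw [spow_succ, sconv]
    refine Finset.sum_eq_zero fun B hB => ?_
    rw [mem_powerset] at hB
    by_cases hsmall : ∑ i ∈ B, x i < c
    · have hrest : (n : ℝ) * c ≤ ∑ i ∈ A \ B, x i := by
        have := Finset.sum_sdiff hB (f := x)
        push_cast at hA
        linarith
      rw [ih hrest, mul_zero]
    · rw [smallFn_eq_zero (not_lt.1 hsmall), zero_mul]

/-- If `A` contains a coordinate `x_i ≥ c` and `x ≥ 0` on `A`, then `N^{⋆n}(A) = 0` for `n ≥ 1`.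
[cite: FordMaynard2024PrimeSieves, Lemma 5.5(a) (proof)] -/
theorem spow_smallFn_eq_zero_of_mem (c : ℝ) (x : α → ℝ) {i : α} (hi : c ≤ x i) :
    ∀ {n : ℕ}, 1 ≤ n → ∀ {A : Finset α}, i ∈ A → (∀ k ∈ A, 0 ≤ x k) →
      spow (smallFn c x) n A = 0 := by
  intro n hn
  -- it is convenient to prove the statement for all `n`, with `δ(A) = 0` for `A ∋ i`
  suffices h : ∀ n (A : Finset α), i ∈ A → (∀ k ∈ A, 0 ≤ x k) → spow (smallFn c x) n A = 0 from
    fun {A} hA hx => h n A hA hx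
  intro n
  induction n with
  | zero => intro A hA _; exact sdelta_of_ne (ne_empty_of_mem hA)
  | succ n ih =>
    intro A hA hx
    rw [spow_succ, sconv]
    refine Finset.sum_eq_zero fun B hB => ?_
    rw [mem_powerset] at hB
    by_cases hiB : i ∈ B
    · have : c ≤ ∑ k ∈ B, x k :=
        hi.trans (Finset.single_le_sum (fun k hk => hx k (hB hk)) hiB)
      rw [smallFn_eq_zero this, zero_mul]
    · rw [ih (A \ B) (mem_sdiff.2 ⟨hA, hiB⟩) (fun k hk => hx k (sdiff_subset hk)), mul_zero]

/-- **Lemma 5.5(a)**: if `x ≥ 0` on `A` and some coordinate `x_i ≥ c`, `i ∈ A`, then `𝓛_c(x_A) = 0`.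
[cite: FordMaynard2024PrimeSieves, Lemma 5.5(a)] -/
theorem linnikFn_eq_zero_of_mem [Fintype α] (c : ℝ) (x : α → ℝ) {A : Finset α} {i : α}
    (hiA : i ∈ A) (hi : c ≤ x i) (hx : ∀ k ∈ A, 0 ≤ x k) : linnikFn c x A = 0 := by
  unfold linnikFn
  refine Finset.sum_eq_zero fun j hj => ?_
  rw [spow_smallFn_eq_zero_of_mem c x hi (Finset.mem_Icc.1 hj).1 hiA hx, mul_zero]

/-- Powers of the singleton indicator: `π^{⋆n}(B) = n! · [|B| = n]`. [folklore] -/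
theorem spow_singletonIndicator (n : ℕ) (B : Finset α) :
    spow (fun C : Finset α => if C.card = 1 then (1 : ℝ) else 0) n B =
      if B.card = n then (n.factorial : ℝ) else 0 := by
  induction n generalizing B with
  | zero =>
    simp only [spow_zero, sdelta, Nat.factorial_zero, Nat.cast_one, Finset.card_eq_zero]
  | succ n ih =>
    rw [spow_succ, sconv]
    -- only singletons `C = {b}`, `b ∈ B`, contribute
    have hsplit : ∑ C ∈ B.powerset, (if C.card = 1 then (1 : ℝ) else 0) *
        spow (fun C : Finset α => if C.card = 1 then (1 : ℝ) else 0) n (B \ C) =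
        ∑ b ∈ B, spow (fun C : Finset α => if C.card = 1 then (1 : ℝ) else 0) n (B \ {b}) := by
      rw [← Finset.sum_filter_add_sum_filter_not B.powerset (fun C => C.card = 1)]
      rw [Finset.sum_eq_zero (s := B.powerset.filter fun C => ¬ C.card = 1)
        (fun C hC => by rw [if_neg (Finset.mem_filter.1 hC).2, zero_mul]), add_zero]
      rw [show B.powerset.filter (fun C => C.card = 1) = B.powersetCard 1 from
        (Finset.powersetCard_eq_filter).symm, Finset.powersetCard_one, Finset.sum_map]
      refine Finset.sum_congr rfl fun b _ => ?_
      simp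
    rw [hsplit]
    simp_rw [ih]
    by_cases hB : B.card = n + 1
    · rw [if_pos hB]
      have : ∀ b ∈ B, (if (B \ {b}).card = n then (n.factorial : ℝ) else 0) = n.factorial := by
        intro b hb
        rw [if_pos]; rw [Finset.card_sdiff_of_subset (Finset.singleton_subset_iff.2 hb)]; simp [hB]
      rw [Finset.sum_congr rfl this, Finset.sum_const, hB, nsmul_eq_mul, Nat.factorial_succ]
      push_cast; ring
    · rw [if_neg hB]
      refine Finset.sum_eq_zero fun b hb => ?_
      rw [if_neg]
      rw [Finset.card_sdiff_of_subset (Finset.singleton_subset_iff.2 hb), Finset.card_singleton]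
      have := Finset.card_pos.2 ⟨b, hb⟩
      omega

/-- `exp_⋆(π) − δ = ζ'` on sets of size `≤ K`: `∑_{i=1}^{K} π^{⋆i}(B)/i! = [B ≠ ∅]`. [folklore] -/
theorem sum_wExp_mul_spow_singletonIndicator {K : ℕ} {B : Finset α} (hB : B.card ≤ K) :
    ∑ i ∈ Finset.Icc 1 K, wExp i * spow (fun C : Finset α => if C.card = 1 then (1 : ℝ) else 0) i B
      = if B.Nonempty then 1 else 0 := by
  simp_rw [spow_singletonIndicator]
  by_cases hBn : B.Nonempty
  · rw [if_pos hBn]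
    have hcard : 1 ≤ B.card := Finset.card_pos.2 hBn
    rw [Finset.sum_eq_single_of_mem B.card (Finset.mem_Icc.2 ⟨hcard, hB⟩)]
    · rw [if_pos rfl, wExp]
      field_simp
    · intro i _ hi; rw [if_neg (Ne.symm hi), mul_zero]
  · rw [if_neg hBn]
    rw [Finset.not_nonempty_iff_eq_empty] at hBn
    subst hBn
    refine Finset.sum_eq_zero fun i hi => ?_
    rw [if_neg, mul_zero]
    have := (Finset.mem_Icc.1 hi).1
    simp only [Finset.card_empty]; omega

/-- **`log_⋆ ∘ exp_⋆`**: `∑_{j=1}^{K} ((−1)^{j+1}/j) ζ'^{⋆j}(A) = [|A| = 1]` for `1 ≤ |A| ≤ K`,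
`ζ' = [· ≠ ∅]` (the coefficient identity `bCoeff_eq`). [folklore] -/
theorem sum_wLinnik_mul_spow_nonemptyIndicator {K : ℕ} {A : Finset α} (hA1 : A.Nonempty)
    (hA : A.card ≤ K) :
    ∑ j ∈ Finset.Icc 1 K, wLinnik j * spow (fun B : Finset α => if B.Nonempty then (1 : ℝ) else 0) j A
      = if A.card = 1 then 1 else 0 := by
  set π : Finset α → ℝ := fun C => if C.card = 1 then (1 : ℝ) else 0 with hπ
  have hπ0 : π ∅ = 0 := by simp [hπ]
  -- replace `ζ'` by `∑_i wExp i π^{⋆i}` on subsets of `A`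
  have hrepl : ∀ j, spow (fun B : Finset α => if B.Nonempty then (1 : ℝ) else 0) j A =
      spow (fun B => ∑ i ∈ Finset.Icc 1 K, wExp i * spow π i B) j A := fun j =>
    spow_congr (fun B hB => (sum_wExp_mul_spow_singletonIndicator ((card_le_card hB).trans hA)).symm) j
  simp_rw [hrepl]
  have hexp : ∀ j ∈ Finset.Icc 1 K, wLinnik j * spow (fun B => ∑ i ∈ Finset.Icc 1 K, wExp i * spow π i B) j A
      = ∑ n ∈ Finset.Icc 1 K, wLinnik j * compSum wExp j n * spow π n A := by
    intro j hj
    rw [spow_sum_spow hπ0 wExp le_rfl (Finset.mem_Icc.1 hj).1 A hA, Finset.mul_sum]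
    exact Finset.sum_congr rfl fun n _ => by ring
  rw [Finset.sum_congr rfl hexp, Finset.sum_comm]
  -- ∑_n (∑_j wLinnik j E_j(n)) π^n(A) = ∑_n bCoeff n π^n(A) = π(A)
  have hb : ∀ n ∈ Finset.Icc 1 K, ∑ j ∈ Finset.Icc 1 K, wLinnik j * compSum wExp j n * spow π n A =
      (if n = 1 then 1 else 0) * spow π n A := by
    intro n hn
    have hn' := Finset.mem_Icc.1 hn
    rw [← Finset.sum_mul, ← bCoeff_eq hn'.1, bCoeff]
    congr 1
    refine (Finset.sum_subset (Finset.Icc_subset_Icc_right hn'.2) fun j hj hjn => ?_).symm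
    simp only [Finset.mem_Icc, not_and, not_le] at hj hjn
    rw [compSum_eq_zero_of_lt wExp (hjn hj.1), mul_zero]
  rw [Finset.sum_congr rfl hb, Finset.sum_eq_single_of_mem 1 (Finset.mem_Icc.2 ⟨le_rfl, by
    have := Finset.card_pos.2 hA1; omega⟩)]
  · rw [if_pos rfl, one_mul, spow_succ, spow_zero, sconv_sdelta]
  · intro n _ hn; rw [if_neg hn, zero_mul]

/-- **Lemma 5.5(b)**: if `x ≥ 0` on `A ≠ ∅` and `∑_{i∈A} x_i < c`, then `𝓛_c(x_A) = [|A| = 1]`.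
[cite: FordMaynard2024PrimeSieves, Lemma 5.5(b)] -/
theorem linnikFn_eq_of_sum_lt [Fintype α] (c : ℝ) (x : α → ℝ) {A : Finset α} (hA : A.Nonempty)
    (hx : ∀ k ∈ A, 0 ≤ x k) (hsum : ∑ i ∈ A, x i < c) :
    linnikFn c x A = if A.card = 1 then 1 else 0 := by
  unfold linnikFn
  have hrepl : ∀ j, spow (smallFn c x) j A =
      spow (fun B : Finset α => if B.Nonempty then (1 : ℝ) else 0) j A := fun j =>
    spow_congr (fun B hB => by
      by_cases hBn : B.Nonempty
      · rw [if_pos hBn]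
        exact smallFn_eq_one hBn ((Finset.sum_le_sum_of_subset_of_nonneg hB
          (fun k hk _ => hx k hk)).trans_lt hsum)
      · rw [if_neg hBn, Finset.not_nonempty_iff_eq_empty.1 hBn, smallFn_empty]) j
  simp_rw [hrepl]
  exact sum_wLinnik_mul_spow_nonemptyIndicator hA (Finset.card_le_univ A)

/-- **The exponential identity behind Lemma 5.4**: for `|A| ≤ K ≤ |α|` and `R ≥ K`,
`∑_{r=1}^{R} (m^r/r!) 𝓛^{⋆r}(A) = ∑_{n=1}^{K} C(m,n) N^{⋆n}(A)` where `𝓛 = 𝓛_c(x_·)` and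
`N = N_{x,c}` (i.e. `exp_⋆(m log_⋆(δ + N)) = (δ + N)^{⋆m}`). [folklore] -/
theorem sum_spow_linnikFn [Fintype α] (c : ℝ) (x : α → ℝ) (m : ℕ) {K R : ℕ} (hKR : K ≤ R) {A : Finset α}
    (hA : A.card ≤ K) (hK : K ≤ Fintype.card α) :
    ∑ r ∈ Finset.Icc 1 R, (m : ℝ) ^ r / r.factorial * spow (linnikFn c x) r A =
      ∑ n ∈ Finset.Icc 1 K, (m.choose n : ℝ) * spow (smallFn c x) n A := by
  have h0 : smallFn c x ∅ = 0 := smallFn_empty c x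
  have hexp : ∀ r ∈ Finset.Icc 1 R, (m : ℝ) ^ r / r.factorial * spow (linnikFn c x) r A =
      ∑ n ∈ Finset.Icc 1 K, (m : ℝ) ^ r / r.factorial * compSum wLinnik r n * spow (smallFn c x) n A := by
    intro r hr
    rw [show linnikFn c x = fun B => ∑ j ∈ Finset.Icc 1 (Fintype.card α), wLinnik j * spow (smallFn c x) j B
      from rfl, spow_sum_spow h0 wLinnik hK (Finset.mem_Icc.1 hr).1 A hA, Finset.mul_sum]
    exact Finset.sum_congr rfl fun n _ => by ring
  rw [Finset.sum_congr rfl hexp, Finset.sum_comm]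
  refine Finset.sum_congr rfl fun n hn => ?_
  have hn' := Finset.mem_Icc.1 hn
  rw [← Finset.sum_mul, ← sum_pow_div_factorial_mul_compSum_wLinnik m (hn'.2.trans hKR)]
  congr 1
  -- the `r = 0` term vanishes since `n ≥ 1`
  rw [show Finset.Icc 1 R = Finset.Ico 1 (R + 1) from rfl, Finset.range_eq_Ico]
  refine Finset.sum_subset (Finset.Ico_subset_Ico_left (by omega)) fun r hr hr' => ?_
  have : r = 0 := by simp only [Finset.mem_Ico] at hr hr'; omega
  rw [this, compSum_zero_of_ne_zero wLinnik (by omega), mul_zero]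

/-- **Lemma 5.4 (Ford–Maynard)**: let `x = (x_i)_{i∈α}`, `|α| = k ≥ 1`, `m ≥ 1`, `c > 0` with
`∑ x_i ≥ m c`. Then `∑_{r=1}^{R} (m^r/r!) ∑_{u₁ ⊔ ⋯ ⊔ u_r = x} ∏ 𝓛_c(u_i) = 0` for every `R ≥ k`, the
inner sum over ordered decompositions into `r` possibly empty subvectors being `𝓛^{⋆r}(univ)`
(terms with `r > k` vanish since `𝓛_c(∅) = 0`). [cite: FordMaynard2024PrimeSieves, Lemma 5.4] -/
theorem FordMaynard_lemma_5_4 [Fintype α] {c : ℝ} (hc : 0 < c) (x : α → ℝ) (m : ℕ) {R : ℕ}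
    (hR : Fintype.card α ≤ R) (hsum : (m : ℝ) * c ≤ ∑ i, x i) :
    ∑ r ∈ Finset.Icc 1 R, (m : ℝ) ^ r / r.factorial * spow (linnikFn c x) r Finset.univ = 0 := by
  rw [sum_spow_linnikFn c x m hR (Finset.card_univ (α := α)).le le_rfl]
  refine Finset.sum_eq_zero fun n hn => ?_
  have hn' := Finset.mem_Icc.1 hn
  by_cases hnm : n ≤ m
  · rw [spow_smallFn_eq_zero c x hn'.1 ?_, mul_zero]
    exact (mul_le_mul_of_nonneg_right (by exact_mod_cast hnm) hc.le).trans hsum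
  · rw [Nat.choose_eq_zero_of_lt (not_le.1 hnm)]; simp

end Linnik

end Literature.Combinatorics.Enumerative
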